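import Literature.AlgebraicGeometry.Motives.GeometricPointsOverClosedPoints
import Mathlib.AlgebraicGeometry.ZariskisMainTheorem
import HarnessLib

/-!
# A proper morphism with finitely many geometric points in every fibre is finite

Topic `Literature/AlgebraicGeometry/Morphisms`; THEOREMS ONLY (no definition, no instance, no notation, no named fact,
no `sorry`).  Cell `hodgecm-mathlib` (D-0151), count-neutral capital (author B-p05 (g16)); consumer: the (h5-C) «`K(L)` is
FINITE over `S`» step (`AbelianSchemes/AbelianSchemeKOfLFinite`).  HC_CM is proved only modulo the 7 printed citations
until rung 0 closes; this file asserts nothing about HC.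

For `f : X → S` locally of finite type and a point `y ∈ S`, write `κ̄ = κ(y)^alg` and `ȳ : Spec κ̄ → S` for the canonical
geometric point over `y`.  If the set `X_y(κ̄) = {x : Spec κ̄ → X ; f ∘ x = ȳ}` of geometric points of the fibre is
FINITE then the topological fibre `f⁻¹(y)` is finite: the scheme-theoretic fibre `X_y` is a `κ(y)`-scheme locally of
finite type whose closed points are the images of its `κ̄`-points ([GortzWedhorn2020] Prop. 5.4, ★ `AlgPoints.range_pt`), hence
finite in number, so `X_y` is discrete (a Jacobson space with finitely many closed points, [GortzWedhorn2020] Prop. 3.35)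
and, being quasi-compact, finite.  Consequently `f` is locally quasi-finite (Mathlib
`LocallyQuasiFinite.of_finite_preimage_singleton`), and a PROPER such `f` is FINITE (Zariski's Main Theorem in the form
«proper + quasi-finite ⇒ finite», [GortzWedhorn2020] Cor. 12.89, Mathlib `IsFinite.of_isProper_of_locallyQuasiFinite`).

* `finite_fiber_of_finite_specOver` — `X_y` (Mathlib `f.fiber y`) is a finite topological space;
* `finite_preimage_singleton_of_finite_specOver` — `f⁻¹(y)` is finite;
* `locallyQuasiFinite_of_finite_specOver`, **`isFinite_of_isProper_of_finite_specOver`**.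

## References
* [GortzWedhorn2020] U. Görtz, T. Wedhorn, *Algebraic Geometry I: Schemes*, 2nd ed. (2020), Prop. 3.35 (p. 82), Prop. 5.4
  (p. 123), Cor. 12.89 (p. 363).
-/

noncomputable section

universe u

open CategoryTheory CategoryTheory.Limits AlgebraicGeometry

namespace Literature.AlgebraicGeometry.Morphisms

open Literature.AlgebraicGeometry.Motives

variable {X S : Scheme.{u}} (f : X ⟶ S)

/-- **Finitely many geometric points in the fibre ⇒ the fibre is a finite space** (for `f` locally of finite type and
quasi-compact): the closed points of `X_y` are images of `κ(y)^alg`-points ([GortzWedhorn2020] Prop. 5.4, ★ `AlgPoints.range_pt`),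
the `κ(y)^alg`-points of `X_y` over `κ(y)` inject into the geometric points of `X` over `ȳ` (universal property of the
fibre product), and a quasi-compact Jacobson space with finitely many closed points is finite.
[cite: GortzWedhorn2020, Prop. 5.4 (p. 123)] [cite: GortzWedhorn2020, Prop. 3.35 (p. 82)] -/
theorem finite_fiber_of_finite_specOver [LocallyOfFiniteType f] [QuasiCompact f] (y : S)
    (h : Finite {x : Spec (.of (AlgebraicClosure (S.residueField y))) ⟶ X //
      x ≫ f = Spec.map (CommRingCat.ofHom (algebraMap (S.residueField y) (AlgebraicClosure (S.residueField y)))) ≫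
        S.fromSpecResidueField y}) :
    Finite (f.fiber y) := by
  -- the fibre as a `κ(y)`-scheme
  haveI : LocallyOfFiniteType (f.fiberToSpecResidueField y) := by
    change LocallyOfFiniteType (pullback.snd _ _)
    infer_instance
  have hF : LocallyOfFiniteType (Over.mk (f.fiberToSpecResidueField y) : SchemeOver (S.residueField y)).hom := by
    change LocallyOfFiniteType (f.fiberToSpecResidueField y)
    infer_instance
  -- `κ̄`-points of the fibre over `κ(y)` inject into geometric points of `X` over `ȳ`
  have hinj : Function.Injective fun P : AlgPoints (Over.mk (f.fiberToSpecResidueField y) : SchemeOver (S.residueField y))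
      (AlgebraicClosure (S.residueField y)) =>
      (⟨P.left ≫ f.fiberι y,
        (Category.assoc _ _ _).trans <| (congrArg (P.left ≫ ·) (f.fiber_fac y)).trans <|
          (Category.assoc _ _ _).symm.trans (congrArg (· ≫ S.fromSpecResidueField y) (Over.w P))⟩ :
        {x : Spec (.of (AlgebraicClosure (S.residueField y))) ⟶ X //
          x ≫ f = Spec.map (CommRingCat.ofHom (algebraMap (S.residueField y) (AlgebraicClosure (S.residueField y)))) ≫
            S.fromSpecResidueField y}) := by
    intro P Q hPQ
    have h1 : P.left ≫ f.fiberι y = Q.left ≫ f.fiberι y := congrArg Subtype.val hPQ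
    refine Over.OverMorphism.ext (pullback.hom_ext h1 ?_)
    change P.left ≫ f.fiberToSpecResidueField y = Q.left ≫ f.fiberToSpecResidueField y
    exact (Over.w P).trans (Over.w Q).symm
  haveI : Finite (AlgPoints (Over.mk (f.fiberToSpecResidueField y) : SchemeOver (S.residueField y))
      (AlgebraicClosure (S.residueField y))) := Finite.of_injective _ hinj
  -- closed points of the fibre are images of `κ̄`-points, hence finite; Jacobson + quasi-compact ⇒ finite
  have hcl : (closedPoints (f.fiber y : Scheme.{u})).Finite := by
    have := AlgPoints.range_pt (X := (Over.mk (f.fiberToSpecResidueField y) : SchemeOver (S.residueField y)))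
    change Set.range _ = closedPoints (f.fiber y : Scheme.{u}) at this
    rw [← this]
    exact Set.finite_range _
  haveI : DiscreteTopology (f.fiber y : Scheme.{u}) := JacobsonSpace.discreteTopology hcl
  exact finite_of_compact_of_discrete

/-- **`f⁻¹(y)` is finite** when the fibre has finitely many geometric points (`f` locally of finite type, quasi-compact).
[cite: GortzWedhorn2020, Prop. 5.4 (p. 123)] [cite: GortzWedhorn2020, Prop. 3.35 (p. 82)] -/
theorem finite_preimage_singleton_of_finite_specOver [LocallyOfFiniteType f] [QuasiCompact f] (y : S)
    (h : Finite {x : Spec (.of (AlgebraicClosure (S.residueField y))) ⟶ X //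
      x ≫ f = Spec.map (CommRingCat.ofHom (algebraMap (S.residueField y) (AlgebraicClosure (S.residueField y)))) ≫
        S.fromSpecResidueField y}) :
    (f ⁻¹' {y} : Set X).Finite := by
  haveI := finite_fiber_of_finite_specOver f y h
  haveI : Finite (f ⁻¹' {y} : Set X) := Finite.of_equiv _ (f.fiberHomeo y).toEquiv
  exact Set.toFinite _

/-- **Finitely many geometric points in every fibre ⇒ locally quasi-finite** (`f` locally of finite type, quasi-compact;
Mathlib `LocallyQuasiFinite.of_finite_preimage_singleton`). [cite: GortzWedhorn2020, Prop. 5.4 (p. 123)] [cite: GortzWedhorn2020, Cor. 12.89 (p. 363)] -/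
theorem locallyQuasiFinite_of_finite_specOver [LocallyOfFiniteType f] [QuasiCompact f]
    (h : ∀ y : S, Finite {x : Spec (.of (AlgebraicClosure (S.residueField y))) ⟶ X //
      x ≫ f = Spec.map (CommRingCat.ofHom (algebraMap (S.residueField y) (AlgebraicClosure (S.residueField y)))) ≫
        S.fromSpecResidueField y}) :
    LocallyQuasiFinite f :=
  LocallyQuasiFinite.of_finite_preimage_singleton f fun y => finite_preimage_singleton_of_finite_specOver f y (h y)

/-- **A PROPER morphism with finitely many geometric points in every fibre is FINITE** (Zariski's Main Theorem,
«finite = proper + quasi-finite», Mathlib `IsFinite.of_isProper_of_locallyQuasiFinite`).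
[cite: GortzWedhorn2020, Cor. 12.89 (p. 363)] [cite: GortzWedhorn2020, Prop. 5.4 (p. 123)] -/
theorem isFinite_of_isProper_of_finite_specOver [IsProper f]
    (h : ∀ y : S, Finite {x : Spec (.of (AlgebraicClosure (S.residueField y))) ⟶ X //
      x ≫ f = Spec.map (CommRingCat.ofHom (algebraMap (S.residueField y) (AlgebraicClosure (S.residueField y)))) ≫
        S.fromSpecResidueField y}) :
    IsFinite f :=
  haveI := locallyQuasiFinite_of_finite_specOver f h
  IsFinite.of_isProper_of_locallyQuasiFinite f

end Literature.AlgebraicGeometry.Morphisms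

end
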